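import Summits.ResolutionOfSingularities.ResolutionOfSingularities.Theorems.HomologicalConductorNoZenoSplitExcCount
import Summits.ResolutionOfSingularities.ResolutionOfSingularities.Theorems.HomologicalConductorNoZenoThreadCount
import Summits.ResolutionOfSingularities.ResolutionOfSingularities.Theorems.HomologicalConductorNoZenoBaseIdealCartier
import Literature.AlgebraicGeometry.Resolution.MinimalResolutionUnique
import HarnessLib

/-!
# Crux `NoZenoR` (stmt-ResolutionOfSingularities-19943), slot 5 `stub_L1wCoreF3` — assembly seam (A5):
# the `N = 0` corner of the sandwich step is VACUOUS (a regular germ carries no sep-X¹-sandwiched 𝔪-primary ideal)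

OURS (cell res-hironaka, chain W4.4; stub worker res-L0-w44-stub-4 g8; object (A5) of res-L0-w44-lead-1's
`B1-CENSUS-g8.md` 5ed4335dffe6c100 §2).  Nothing here is a statement of the manuscript under review (Hironaka 2017);
AI-written, weaker than expert review; def-free; no `Sig` of the crux skeleton is restated (BRICK RULE).

`Beta2Descent.Sig.L1Core HasSplitExcCurveCountLE IsSepX1Sandwiched` (= `stub_L1wCore`) concludes, for a
two-dimensional rational germ `D` with split count `N^s(D) ≤ N` and an `𝔪_D`-primary sep-X¹-sandwiched ideal `I`,
that the next germ is regular or rational with `N^s ≤ N − 1`.  The by-name closer wants `1 ≤ N` (so that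
`N − 1 + 1 = N`); this file shows that the binders of `L1Core` are CONTRADICTORY at `N = 0`:

* `toStalk_eq_stalkMap_comp`, `bijective_toStalk_of_isIso` — API for the structure map
  `toStalk f y : R → 𝒪_(Y,y)` of U8b (`…NoZenoSplitExcCount`): it is `f.stalkMap y` after `R → 𝒪_(Spec R, f y)`,
  hence BIJECTIVE at the point over the closed point when `f` is an isomorphism (LOCAL there by the lead's
  `isLocalHom_toStalk_of_base_eq`, `…NoZenoBaseIdealCartier`, imported);
* `isIso_of_isMinimalResolution_of_isRegular` — a minimal resolution (universal-property form) of a REGULAR scheme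
  is an isomorphism (tree `isMinimalResolution_id` + `IsMinimalResolution.isIso_of_comp_eq`);
* `excCurvePoints_eq_empty_of_isIso`, `sepNodes_eq_empty_of_excCurvePoints_eq_empty`,
  `isIso_of_isBlowup_of_sepNodes_eq_empty` — an isomorphism onto `Spec R` has no exceptional curve, hence no
  κ^sep-node, and the blow-up of the (empty) node set is an isomorphism (`vanishingIdeal ⊥ = ⊤`, tree
  `IsBlowup.isIso`);
* `not_isPrincipal_of_radical_eq_maximalIdeal` — Krull: in a Noetherian local ring of dimension `≥ 2` no
  `𝔪`-primary ideal is principal (Mathlib `Ideal.height_le_one_of_isPrincipal_of_mem_minimalPrimes`);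
* **`not_isSepX1Sandwiched_of_isRegularLocalRing`** — for `R` regular local of dimension `≥ 2` and
  `√I = 𝔪_R`, `¬ IsSepX1Sandwiched R I`: both morphisms in the definition are isomorphisms, so at the point of
  `X¹ ≅ Spec R` over `𝔪` the ideal `I·𝒪 ≅ I` would be principal;
* **`false_of_hasSplitExcCurveCountLE_zero_of_isSepX1Sandwiched`** — the (A5) corner: a two-dimensional normal
  Noetherian local domain with `N^s ≤ 0` is regular (U7/U8a + `Thread.isRegularLocalRing_of_hasExcCurveCountLE_zero`),
  contradiction; and **`L1Core_corner_zero`** — the same in the EXACT binder shape of `Sig.L1Core` at `N = 0`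
  (`D := locPrime T P`, `I := span {d | ↑d ∈ C}`), so the slot-5 closer may open with
  `rcases Nat.eq_zero_or_pos N`.

References: J. Lipman, Publ. Math. IHÉS 36 (1969), Thm. (4.1) p. 208 (minimal resolutions) [`Lipman1969`];
U. Görtz, T. Wedhorn, *Algebraic Geometry I* (2020), Def. 13.90 / (13.19) (blow-ups) [`GortzWedhorn2020`].
-/

noncomputable section

-- single-problem summit: the doubled namespace component `ResolutionOfSingularities` is forced
set_option linter.dupNamespace false

namespace Summit.ResolutionOfSingularities.ResolutionOfSingularities.Theorems.NoZeno.ExcCount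

open CategoryTheory AlgebraicGeometry IsLocalRing TopologicalSpace
open Literature.AlgebraicGeometry.Resolution

/-! ## The structure map `toStalk f y : R → 𝒪_(Y,y)` -/

section ToStalk

variable {R : Type} [CommRing R] {Y : Scheme.{0}} (f : Y ⟶ Spec (.of R)) (y : Y)

/-- `toStalk f y` is the stalk map `f.stalkMap y : 𝒪_(Spec R, f y) → 𝒪_(Y, y)` precomposed with the structure
map `R ≅ Γ(Spec R) → 𝒪_(Spec R, f y)`. [folklore] -/
theorem toStalk_eq_stalkMap_comp :
    toStalk f y = (f.stalkMap y).hom.comp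
      (((Spec (.of R)).presheaf.germ ⊤ (f.base y) trivial).hom.comp (Scheme.ΓSpecIso (.of R)).inv.hom) := by
  ext r
  change (Y.presheaf.germ ⊤ y trivial).hom (f.appTop.hom ((Scheme.ΓSpecIso (.of R)).inv.hom r)) =
    (f.stalkMap y).hom (((Spec (.of R)).presheaf.germ ⊤ (f.base y) trivial).hom
      ((Scheme.ΓSpecIso (.of R)).inv.hom r))
  rw [Scheme.Hom.germ_stalkMap_apply]
  rfl

/-- Over the closed point of a local `R`, the structure map `R → 𝒪_(Spec R, 𝔪)` is a bijection (it is the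
inverse of Mathlib's `stalkClosedPointIso`). [folklore] -/
theorem bijective_germ_comp_of_eq_closedPoint [IsLocalRing R] :
    ∀ p : Spec (.of R), p = closedPoint R →
      Function.Bijective ((((Spec (.of R)).presheaf.germ ⊤ p trivial).hom).comp
        (Scheme.ΓSpecIso (.of R)).inv.hom) := by
  rintro p rfl
  have h : (Scheme.ΓSpecIso (.of R)).inv ≫ (Spec (.of R)).presheaf.germ ⊤ (closedPoint R) trivial =
      (stalkClosedPointIso (.of R)).inv := by
    rw [← ΓSpecIso_hom_stalkClosedPointIso_inv, Iso.inv_hom_id_assoc]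
  have h' : (((Spec (.of R)).presheaf.germ ⊤ (closedPoint R) trivial).hom).comp
      (Scheme.ΓSpecIso (.of R)).inv.hom = (stalkClosedPointIso (.of R)).inv.hom := by
    rw [← CommRingCat.hom_comp, h]
  rw [h']
  exact ConcreteCategory.bijective_of_isIso (stalkClosedPointIso (.of R)).inv

/-- When `f : Y ⟶ Spec R` is an isomorphism, `toStalk f y` is a BIJECTION `R → 𝒪_(Y,y)` at the point `y` over the
closed point. [folklore] -/
theorem bijective_toStalk_of_isIso [IsLocalRing R] [IsIso f] (hy : f.base y = closedPoint R) :
    Function.Bijective (toStalk f y) := by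
  rw [toStalk_eq_stalkMap_comp, RingHom.coe_comp]
  exact (ConcreteCategory.bijective_of_isIso (f.stalkMap y)).comp
    (bijective_germ_comp_of_eq_closedPoint (R := R) (f.base y) hy)

end ToStalk

/-! ## Minimal resolutions of regular schemes; exceptional curves and nodes of an isomorphism -/

/-- **A minimal resolution of a regular scheme is an isomorphism**: the identity is a minimal resolution
(`isMinimalResolution_id`) and any morphism over the base between two minimal resolutions is an isomorphism
(`IsMinimalResolution.isIso_of_comp_eq`). [cite: Lipman1969, Theorem (4.1) (p. 208)] -/
theorem isIso_of_isMinimalResolution_of_isRegular {X S : Scheme.{0}} {π : X ⟶ S} (hπ : IsMinimalResolution π)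
    (hS : Scheme.IsRegular S) : IsIso π :=
  hπ.isIso_of_comp_eq (isMinimalResolution_id hS) π (Category.comp_id π)

/-- An ISOMORPHISM onto `Spec R`, `R` local, has no integral exceptional curve: the point over the closed point is
specialised to by every point (pull back `y ⤳ 𝔪` along the embedding `π`), so its height is `0 ≠ 1`.
[cite: Lipman1969, Section 12 (p. 220)] -/
theorem excCurvePoints_eq_empty_of_isIso {R : Type} [CommRing R] [IsLocalRing R] {X : Scheme.{0}}
    (π : X ⟶ Spec (.of R)) [IsIso π] : excCurvePoints π = ∅ := by
  ext η
  simp only [excCurvePoints, Set.mem_setOf_eq, Set.mem_empty_iff_false, iff_false, not_and]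
  intro hη h1
  have h0 : Order.height η = 0 := height_eq_zero_of_forall_specializes η fun y => by
    have hy : π.base y ⤳ π.base η := by
      rw [hη]
      exact (PrimeSpectrum.le_iff_specializes (π.base y) (closedPoint R)).mp
        (IsLocalRing.le_maximalIdeal (π.base y).2.ne_top)
    exact π.isOpenEmbedding.isInducing.specializes_iff.mp hy
  rw [h0] at h1
  exact zero_ne_one h1

/-- No exceptional curve ⇒ no κ^sep-node (every node carries a branch of an exceptional curve). [this work] -/
theorem sepNodes_eq_empty_of_excCurvePoints_eq_empty {R : Type} [CommRing R] [IsLocalRing R] {X : Scheme.{0}}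
    (π : X ⟶ Spec (.of R)) (h : excCurvePoints π = ∅) : sepNodes π = ∅ := by
  ext z
  simp only [mem_sepNodes_iff, Set.mem_empty_iff_false, iff_false, not_and]
  intro _
  rintro (⟨b, b', -, hb, -⟩ | ⟨η, hηz, V, hb, hη, -⟩)
  · have hb1 : b.1 ∈ excCurvePoints π := hb.1
    rw [h] at hb1
    exact hb1
  · rw [h] at hη
    exact hη

/-- The blow-up of the (closure of the) node set is an isomorphism when there is no node: its centre is the unit
ideal sheaf (`vanishingIdeal ⊥ = ⊤`), an effective Cartier divisor. [cite: GortzWedhorn2020, (13.19) p. 413] -/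
theorem isIso_of_isBlowup_of_sepNodes_eq_empty {R : Type} [CommRing R] [IsLocalRing R] {X X1 : Scheme.{0}}
    (π : X ⟶ Spec (.of R)) {ρ : X1 ⟶ X}
    (hρ : IsBlowup ρ (Scheme.IdealSheafData.vanishingIdeal ⟨closure (sepNodes π), isClosed_closure⟩))
    (h : sepNodes π = ∅) : IsIso ρ := by
  have hbot : (⟨closure (sepNodes π), isClosed_closure⟩ : Closeds X) = ⊥ := by
    apply Closeds.ext
    simp [h]
  rw [hbot, Scheme.IdealSheafData.vanishingIdeal_bot] at hρ
  exact hρ.isIso isEffectiveCartier_top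

/-! ## No sep-X¹-sandwiched 𝔪-primary ideal on a regular germ of dimension `≥ 2` -/

/-- **Krull**: in a Noetherian local ring of dimension `≥ 2`, an ideal with radical `𝔪` is not principal
(`𝔪` would be minimal over a principal ideal, of height `≤ 1`). [folklore] -/
theorem not_isPrincipal_of_radical_eq_maximalIdeal {R : Type*} [CommRing R] [IsLocalRing R] [IsNoetherianRing R]
    (h2 : (2 : WithBot ℕ∞) ≤ ringKrullDim R) {I : Ideal R} (hI : I.radical = maximalIdeal R) :
    ¬ I.IsPrincipal := by
  intro hP
  have hmin : maximalIdeal R ∈ I.minimalPrimes := by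
    rw [← Ideal.radical_minimalPrimes, hI, Ideal.minimalPrimes_eq_subsingleton_self]
    exact Set.mem_singleton _
  have h1 : (maximalIdeal R).height ≤ 1 := Ideal.height_le_one_of_isPrincipal_of_mem_minimalPrimes I _ hmin
  have hdim : ringKrullDim R ≤ 1 := by
    rw [← IsLocalRing.maximalIdeal_height_eq_ringKrullDim]
    exact_mod_cast h1
  have h21 : (2 : WithBot ℕ∞) ≤ 1 := h2.trans hdim
  exact absurd h21 (by decide)

/-- A bijective ring homomorphism pulls principal ideals back to principal ideals: if `I·S` (the image ideal) is
principal then so is `I`. [folklore] -/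
theorem isPrincipal_of_isPrincipal_map_of_bijective {R S : Type*} [CommRing R] [CommRing S] (φ : R →+* S)
    (hφ : Function.Bijective φ) {I : Ideal R} (h : (I.map φ).IsPrincipal) : I.IsPrincipal := by
  obtain ⟨g, hg⟩ := h
  obtain ⟨a, rfl⟩ := hφ.2 g
  have hI : I = (I.map φ).comap φ := (Ideal.comap_map_of_bijective φ hφ).symm
  refine ⟨⟨a, le_antisymm ?_ ?_⟩⟩
  · intro b hb
    have hb' : φ b ∈ I.map φ := Ideal.mem_map_of_mem φ hb
    rw [hg] at hb'
    obtain ⟨c, hc⟩ := Ideal.mem_span_singleton'.mp hb'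
    obtain ⟨d, rfl⟩ := hφ.2 c
    rw [← map_mul] at hc
    have hbd : b = d * a := (hφ.1 hc).symm
    rw [hbd]
    exact Ideal.mem_span_singleton'.mpr ⟨d, rfl⟩
  · rw [Ideal.span_le, Set.singleton_subset_iff, hI, SetLike.mem_coe, Ideal.mem_comap, hg]
    exact Ideal.mem_span_singleton_self _

/-- **A regular local ring of dimension `≥ 2` carries no sep-X¹-sandwiched ideal with radical `𝔪`.**  In
`IsSepX1Sandwiched R I` the minimal resolution `π : X → Spec R` is an isomorphism (`Spec R` is regular), it has no
exceptional curve and no node, so the node blow-up `ρ : X¹ → X` is an isomorphism too; at the point `x₁` of `X¹`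
over `𝔪` the structure map `toStalk (ρ ≫ π) x₁ : R → 𝒪_(X¹,x₁)` is a local bijection, so `I·𝒪_(X¹,x₁)` principal
forces `I` principal — impossible for an `𝔪`-primary ideal in dimension `≥ 2` (Krull). [this work] -/
theorem not_isSepX1Sandwiched_of_isRegularLocalRing {R : Type} [CommRing R] [IsRegularLocalRing R]
    (h2 : (2 : WithBot ℕ∞) ≤ ringKrullDim R) {I : Ideal R} (hI : I.radical = maximalIdeal R) :
    ¬ IsSepX1Sandwiched R I := by
  rintro ⟨X, π, hπ, X1, ρ, hρ, hprin⟩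
  haveI := isRegularRing_of_isRegularLocalRing R
  haveI : IsIso π := isIso_of_isMinimalResolution_of_isRegular hπ (Scheme.isRegular_Spec (.of R))
  haveI : IsIso ρ :=
    isIso_of_isBlowup_of_sepNodes_eq_empty π hρ
      (sepNodes_eq_empty_of_excCurvePoints_eq_empty π (excCurvePoints_eq_empty_of_isIso π))
  -- the point of `X¹ ≅ Spec R` over the closed point
  obtain ⟨x₁, hx₁⟩ : ∃ x₁ : X1, (ρ ≫ π).base x₁ = closedPoint R :=
    ⟨(inv (ρ ≫ π)).base (closedPoint R), by
      rw [← Scheme.Hom.comp_apply, IsIso.inv_hom_id, Scheme.Hom.id_base]; rfl⟩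
  have hloc : IsLocalHom (toStalk (ρ ≫ π) x₁) := isLocalHom_toStalk_of_base_eq (ρ ≫ π) hx₁
  have hbij : Function.Bijective (toStalk (ρ ≫ π) x₁) := bijective_toStalk_of_isIso _ _ hx₁
  exact not_isPrincipal_of_radical_eq_maximalIdeal h2 hI
    (isPrincipal_of_isPrincipal_map_of_bijective _ hbij (hprin x₁ hloc))

/-! ## The (A5) corner of `stub_L1wCore`: split count `0` is incompatible with a sandwiched 𝔪-primary ideal -/

/-- **(A5), abstract form.**  For a two-dimensional normal Noetherian local domain `R`: `N^s(R) ≤ 0` and an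
`𝔪_R`-primary sep-X¹-sandwiched ideal cannot coexist — `N^s ≤ 0 ⇒ N ≤ 0 ⇒ R regular`
(`hasExcCurveCountLE_of_hasSplitExcCurveCountLE`, `Thread.isRegularLocalRing_of_hasExcCurveCountLE_zero`), then
`not_isSepX1Sandwiched_of_isRegularLocalRing`. [this work] -/
theorem false_of_hasSplitExcCurveCountLE_zero_of_isSepX1Sandwiched {R : Type} [CommRing R] [IsLocalRing R]
    [IsNoetherianRing R] [IsDomain R] [IsIntegrallyClosed R] (h2 : ringKrullDim R = 2) {I : Ideal R}
    (hI : I.radical = maximalIdeal R) (h0 : HasSplitExcCurveCountLE R 0) (hS : IsSepX1Sandwiched R I) :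
    False := by
  haveI : IsRegularLocalRing R :=
    SandwichCluster.Thread.isRegularLocalRing_of_hasExcCurveCountLE_zero h2
      (hasExcCurveCountLE_of_hasSplitExcCurveCountLE h0)
  exact not_isSepX1Sandwiched_of_isRegularLocalRing h2.ge hI hS

/-- `N^s(R) ≤ 0` fails along with any `𝔪`-primary sep-X¹-sandwiched ideal (contrapositive packaging of the corner).
[this work] -/
theorem not_hasSplitExcCurveCountLE_zero_of_isSepX1Sandwiched {R : Type} [CommRing R] [IsLocalRing R]
    [IsNoetherianRing R] [IsDomain R] [IsIntegrallyClosed R] (h2 : ringKrullDim R = 2) {I : Ideal R}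
    (hI : I.radical = maximalIdeal R) (hS : IsSepX1Sandwiched R I) : ¬ HasSplitExcCurveCountLE R 0 :=
  fun h0 => false_of_hasSplitExcCurveCountLE_zero_of_isSepX1Sandwiched h2 hI h0 hS

/-- Hence a germ carrying an `𝔪`-primary sep-X¹-sandwiched ideal with `N^s ≤ N` has `1 ≤ N` — the form the
slot-5 closer uses to rewrite `N - 1 + 1 = N`. [this work] -/
theorem one_le_of_hasSplitExcCurveCountLE_of_isSepX1Sandwiched {R : Type} [CommRing R] [IsLocalRing R]
    [IsNoetherianRing R] [IsDomain R] [IsIntegrallyClosed R] (h2 : ringKrullDim R = 2) {I : Ideal R}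
    (hI : I.radical = maximalIdeal R) (hS : IsSepX1Sandwiched R I) {N : ℕ} (hN : HasSplitExcCurveCountLE R N) :
    1 ≤ N := by
  rcases Nat.eq_zero_or_pos N with rfl | hpos
  · exact (false_of_hasSplitExcCurveCountLE_zero_of_isSepX1Sandwiched h2 hI hN hS).elim
  · exact hpos

end Summit.ResolutionOfSingularities.ResolutionOfSingularities.Theorems.NoZeno.ExcCount

/-! ## The corner in the EXACT binder shape of `Beta2Descent.Sig.L1Core` (`D := locPrime T P`) -/

namespace Summit.ResolutionOfSingularities.ResolutionOfSingularities.Theorems.NoZeno.SandwichCluster.Thread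

open IsLocalRing
open Summit.ResolutionOfSingularities.ResolutionOfSingularities.Theorems.NoZeno.ExcCount
  (HasSplitExcCurveCountLE IsSepX1Sandwiched false_of_hasSplitExcCurveCountLE_zero_of_isSepX1Sandwiched)

variable {k K : Type} [Field k] [Field K] [Algebra k K]

/-- **(A5) for `stub_L1wCore` at `N = 0`, binders verbatim from `Sig.L1Core`** (`T` essentially of finite type
over `k` and normal, `D := locPrime T P` of dimension `2`, `C ⊆ K`, the ideal `span {d : D | ↑d ∈ C}` with radical
`𝔪_D`, sep-X¹-sandwiched; the measure hypothesis `HasSplitExcCurveCountLE D 0`): CONTRADICTION.  `D` is a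
Noetherian normal local domain as a prime localisation of `T` (`isLocalization_locPrime`,
`isIntegrallyClosed_locPrime`). [this work] -/
theorem L1Core_corner_zero (T : Subalgebra k K) (P : Ideal ↥T) (hP : P.IsPrime)
    (hET : Algebra.EssFiniteType k ↥T) (hTIC : IsIntegrallyClosed ↥T)
    (hdim : ringKrullDim ↥(Parasite.locPrime T P hP) = 2) (C : Set K)
    (hrad : (Ideal.span {d : ↥(Parasite.locPrime T P hP) | (d : K) ∈ C}).radical =
      @maximalIdeal ↥(Parasite.locPrime T P hP) _ (Parasite.isLocalRing_locPrime T P hP))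
    (h0 : @HasSplitExcCurveCountLE ↥(Parasite.locPrime T P hP) _ (Parasite.isLocalRing_locPrime T P hP) 0)
    (hS : @IsSepX1Sandwiched ↥(Parasite.locPrime T P hP) _ (Parasite.isLocalRing_locPrime T P hP)
      (Ideal.span {d : ↥(Parasite.locPrime T P hP) | (d : K) ∈ C})) : False := by
  haveI := hP
  haveI := hET
  haveI := Parasite.isLocalRing_locPrime T P hP
  haveI : IsNoetherianRing ↥T := Algebra.EssFiniteType.isNoetherianRing k ↥T
  haveI : IsNoetherianRing ↥(Parasite.locPrime T P hP) := by
    letI : Algebra ↥T ↥(Parasite.locPrime T P hP) :=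
      (Subring.inclusion (toSubring_le_locPrime T P hP)).toAlgebra
    haveI := isLocalization_locPrime T P hP
    exact IsLocalization.isNoetherianRing P.primeCompl _ inferInstance
  haveI : IsIntegrallyClosed ↥(Parasite.locPrime T P hP) := by
    haveI := hTIC
    exact isIntegrallyClosed_locPrime T P hP
  exact false_of_hasSplitExcCurveCountLE_zero_of_isSepX1Sandwiched hdim hrad h0 hS

end Summit.ResolutionOfSingularities.ResolutionOfSingularities.Theorems.NoZeno.SandwichCluster.Thread

end
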